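import Summits.CriticalPhenomena.PercolationContinuityZ3.Theorems.PercNearOneGluingNoHeavyLowerTailSahiSunflowerAllOrders
import Summits.CriticalPhenomena.PercolationContinuityZ3.Theorems.PercNearOneGluingNoHeavyLowerTailThreePointLBSwitching
import Literature.Combinatorics.Sahi2008.Percolation
import Literature.Combinatorics.Sahi2008.PushForward
import HarnessLib

/-!
# `NoHeavyLowerTail` (crux stmt-CriticalPhenomena-4575), master-family line P2: every order of Sahi's hierarchy for the
# DECREASING 3-point connectivity-pattern algebra, on every finite weighted graph (from `3PT-LB`)

Support file (seat `prim-masterthm-p2`, `--supports stmt-CriticalPhenomena-4575 --as helper`); no named fact, no sorry.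
Companion of `…SahiSunflowerAllOrders.lean` (`M3.sahiPositive_of_cubic`: on the five-point sunflower poset `M₃`,
Sahi positivity of every order follows from the single cubic `E₃(χ_{D₀},χ_{D₁},χ_{D₂}) ≥ 0`).

Here the cubic is discharged for the 3-point law of Bernoulli bond percolation with arbitrary edge weights: the
pattern map `pat3 a b c : BondConfig V → M₃` (all joined ↦ `core`; exactly the pair `ab/ac/bc` joined ↦ `pet 0/1/2`;
no pair joined ↦ `out`) pulls the up-sets `D 0, D 1, D 2` back to the separations `{a≁b}, {a≁c}, {b≁c}`
(`setInd_D_comp_pat3`), so the cubic of the pushed-forward weight is `E₃({a≁b},{a≁c},{b≁c}) = 3PT-LB = SHK3⁺ ≥ 0`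
(`ThreePointLB.sahiE3_pairSep_nonneg`, prim-cert-2/prim-lit-2) — `pat3_cubic_nonneg`.  Consequences:
* `sahiPositive_pat3` — the 3-point pattern weight `(t; u₁,u₂,u₃; q)` of ANY finite weighted graph is Sahi-positive of
  EVERY order;
* `sahiE_threePointPattern_nonneg` — `E_n(f₀ ∘ pat3, …, f_{n−1} ∘ pat3) ≥ 0` under the percolation weight for every
  `n` and all nonnegative `f_i : M₃ → ℝ` increasing from `core` to `out`, i.e. for all nonnegative pattern-measurable
  functions DECREASING in the configuration (every multiset of the indicators of `{a≁b}, {a≁c}, {b≁c}`, `{x | yz}`,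
  `{a|b|c}`, …).  Before this file the tree had these rows for `n = 3` (3PT-LB) and for nested/chain families only.
The INCREASING side of the same algebra is, by `M3.sahiPositive_m3_iff` for the reversed weight `(q; u; t)`, equivalent
to the open row `T_inc = (1+q)(qt − e₂) − e₃ ≥ 0` (`TIncRow`, proved there for `q ≥ t`); nothing is claimed about it.
-/

/-! ## Part 3.  The 3-point percolation law: every order, unconditionally (from `3PT-LB`) -/

namespace Summit.CriticalPhenomena.PercolationContinuityZ3.Theorems.SahiDeltaSystem

open Finset Function MeasureTheory Literature.Combinatorics.Sahi2008
open Literature.Probability.LatticeModels (prodBernoulli sahiE3)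
open Literature.Probability.Percolation
open Literature.Probability.Percolation.DecisionTree (ind ind_of_mem ind_of_not_mem ind_nonneg)
open M3

variable {V : Type*} [Fintype V]

/-- The connectivity PATTERN of three vertices, as a point of `M₃`: `core` if `a, b, c` are all joined, `pet 0 / pet 1 /
pet 2` if exactly the pair `ab / ac / bc` is joined, `out` if no pair is joined.  (Antitone in the configuration: the
up-sets `D 0, D 1, D 2` of `M₃` pull back to the SEPARATION events `{a≁b}, {a≁c}, {b≁c}`.) [this work] -/
noncomputable def pat3 (a b c : V) (ω : BondConfig V) : M3 := by
  classical
  exact if ω ∈ openConn a b ∧ ω ∈ openConn a c then core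
    else if ω ∈ openConn a b then pet 0 else if ω ∈ openConn a c then pet 1
    else if ω ∈ openConn b c then pet 2 else out

omit [Fintype V] in
/-- The up-sets `D i` of `M₃` pull back along the pattern map to the three pairwise separation events. [this work] -/
theorem setInd_D_comp_pat3 (a b c : V) :
    (setInd (D 0) ∘ pat3 a b c = ind (openConn a b)ᶜ) ∧ (setInd (D 1) ∘ pat3 a b c = ind (openConn a c)ᶜ) ∧
      (setInd (D 2) ∘ pat3 a b c = ind (openConn b c)ᶜ) := by
  have tr1 : ∀ ω : BondConfig V, ω ∈ openConn a b → ω ∈ openConn a c → ω ∈ openConn b c :=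
    fun ω h1 h2 => SimpleGraph.Reachable.trans (SimpleGraph.Reachable.symm h1) h2
  have tr2 : ∀ ω : BondConfig V, ω ∈ openConn a b → ω ∈ openConn b c → ω ∈ openConn a c :=
    fun ω h1 h2 => SimpleGraph.Reachable.trans h1 h2
  have tr3 : ∀ ω : BondConfig V, ω ∈ openConn a c → ω ∈ openConn b c → ω ∈ openConn a b :=
    fun ω h1 h2 => SimpleGraph.Reachable.trans h1 (SimpleGraph.Reachable.symm h2)
  refine ⟨?_, ?_, ?_⟩ <;> funext ω <;>
    simp only [Function.comp, setInd_apply, D, Finset.mem_erase, Finset.mem_univ, pat3, ind, Set.mem_compl_iff] <;>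
    by_cases h1 : ω ∈ openConn a b <;> by_cases h2 : ω ∈ openConn a c <;> by_cases h3 : ω ∈ openConn b c <;>
    simp (config := { decide := true }) [h1, h2, h3] <;>
    first | exact absurd (tr1 ω h1 h2) h3 | exact absurd (tr2 ω h1 h3) h2 | exact absurd (tr3 ω h2 h3) h1

/-- **The cubic of the 3-point pattern weight is `3PT-LB`.**  For every finite weighted graph and vertices `a b c`,
`E₃(χ_{D₀}, χ_{D₁}, χ_{D₂}) ≥ 0` under the push-forward of the percolation weight along `pat3`, by
`ThreePointLB.sahiE3_pairSep_nonneg`. [this work] -/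
theorem pat3_cubic_nonneg (w : Sym2 V → unitInterval) (a b c : V) :
    0 ≤ sahiE (pushWeight (bernoulliWeight w) (pat3 a b c)) 3 ![setInd (D 0), setInd (D 1), setInd (D 2)] := by
  rw [sahiE_pushWeight]
  obtain ⟨h0, h1, h2⟩ := setInd_D_comp_pat3 (V := V) a b c
  have e : (fun i => (![setInd (D 0), setInd (D 1), setInd (D 2)] : Fin 3 → M3 → ℝ) i ∘ pat3 a b c) =
      ![ind (openConn a b)ᶜ, ind (openConn a c)ᶜ, ind (openConn b c)ᶜ] := by
    funext i
    fin_cases i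
    · exact h0
    · exact h1
    · exact h2
  rw [e, sahiE_three_ind]
  exact ThreePointLB.sahiE3_pairSep_nonneg w a b c

/-- **All orders for the 3-point law.**  The pattern weight of three vertices of ANY finite weighted graph is
Sahi-positive of EVERY order (from `3PT-LB` and `sahiPositive_of_cubic`). [this work] -/
theorem sahiPositive_pat3 (w : Sym2 V → unitInterval) (a b c : V) (n : ℕ) :
    SahiPositive (pushWeight (bernoulliWeight w) (pat3 a b c)) n :=
  sahiPositive_of_cubic (fun x => pushWeight_nonneg (isFKGMeasure_bernoulliWeight w).nonneg _ x)
    (by rw [sum_pushWeight, sum_bernoulliWeight]) (pat3_cubic_nonneg w a b c) n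

/-- **Every `E_n` of decreasing 3-point pattern functions is nonnegative** (all graphs, all edge weights, all `n`):
for nonnegative increasing `f_i : M₃ → ℝ` (i.e. `f_i ∘ pat3` nonnegative pattern-measurable functions that are
DECREASING in the configuration — e.g. any multiset of the indicators of `{a≁b}, {a≁c}, {b≁c}`, `{x | yz}`, `{a|b|c}`),
`E_n(f₀ ∘ pat3, …, f_{n−1} ∘ pat3) ≥ 0` under the percolation weight.  The increasing side is equivalent to the open
row `T_inc` (`TIncRow`), not claimed. [this work] -/
theorem sahiE_threePointPattern_nonneg (w : Sym2 V → unitInterval) (a b c : V) {n : ℕ} (f : Fin n → M3 → ℝ)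
    (hf0 : ∀ i x, 0 ≤ f i x) (hmono : ∀ i, Monotone (f i)) :
    0 ≤ sahiE (bernoulliWeight w) n fun i => f i ∘ pat3 a b c := by
  rw [← sahiE_pushWeight]
  exact sahiPositive_pat3 w a b c n f hf0 hmono

end Summit.CriticalPhenomena.PercolationContinuityZ3.Theorems.SahiDeltaSystem
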